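import Mathlib

/-!
# ReflexSignature — the reflex field of the τ-nearby unitary Shimura datum (sub-claim B2)

Liu 2021, Appendix C.1 (journal p. 107 ll. 21–46, p. 108 ll. 28–29): for a hermitian space
`V` of rank `n` over a CM field `E` with signatures `(p_τ, q_τ)` at the real places `τ` and a
CM type `Φ`, the two elements `sig_{V,Φ} = Σ_τ (p_τ τ⁺ + q_τ τ⁻)` and `sig'_{V,Φ} = Σ_τ q_τ τ⁻`
of the free commutative monoid `ℕ[Φ_E]` (where `τ⁻ ∈ Φ`, `τ⁺ ∈ Φ^c` lie above `τ`) carry the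
action of `Gal(ℂ/ℚ)` through its action on `Φ_E`; the reflex field (resp. reduced reflex
field) of `(V, Φ)` is the fixed field of the stabiliser of `sig_{V,Φ}` (resp. `sig'_{V,Φ}`)
(Definition C.1), and the reflex field of the Shimura datum `(G, h_{V,Φ})` is the reduced one.

This file is the finite-group content of route/T4-B2-p4.md, B2.4 (statement (B2-ii)):
an element of `ℕ[Emb]` is modelled by its coefficient function `n : Emb → ℕ`, the Galois action on
`Emb` by a `MulAction`, and the stabiliser of the element by `sigStabilizer`. Results:

* `sigStabilizer_le_stabilizer`: if some value of `n` is taken at exactly one point `τ₁`, the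
  stabiliser of the element is contained in the stabiliser of `τ₁` (B2.4(a), (e));
* `sigStabilizer_reducedSig`: for `sig' = 1·τ₁` (the nearby signature `(n−1,1)` at one real
  place and `(n,0)` at the others) the stabiliser is exactly the stabiliser of `τ₁` (B2.4(a));
* `nearbyFullSig_eq_one_iff`: the non-reduced element `sig = (n−1)·τ̄₁ + 1·τ₁ + n·(Φ^c ∖ {τ̄₁})`
  takes the value `1` only at `τ₁` when `n ≠ 1, 2` (B2.4(e));
* `reflexFieldOfSig_eq_top`: in the finite Galois model `Gal(L/K)` the reflex field is `⊤ = L`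
  as soon as `τ₁` has trivial stabiliser (B2.4(c), (e));
* `stabilizer_eq_bot_of_surjective`, `reflexFieldOfSig_eq_top_of_surjective`: for the action of
  `Gal(L/K)` on the embeddings `F →ₐ[K] L` by composition (Liu p. 107 l. 16), a SURJECTIVE
  embedding `τ₁` (i.e. `τ₁(F) = L`: the Galois case `L = F₁ = τ₁(F)`) has trivial stabiliser, so
  both reflex fields of the nearby datum are `L = τ₁(F)` — Liu Rem. C.2 «the reflex field of
  `h_{V,τ'}` is `τ'(E)`», kernel-checked in this model.

Nothing here mentions a hermitian space or a Shimura variety: the geometric content of B2 is in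
the prose; this file checks the combinatorics of Definition C.1 that the prose uses.
-/

namespace Summit.Ventures.HodgeRepro2.ReflexSignature

open MulAction

section Stabilizer

variable (G : Type*) [Group G] {Emb : Type*} [MulAction G Emb]

/-- Liu Def. C.1 (the group side): the stabiliser in `G` of the element `Σ_{τ'} n(τ')·τ'` of
`ℕ[Emb]`, i.e. the subgroup of those `σ` with `n (σ • τ') = n τ'` for every `τ'`. -/
def sigStabilizer (n : Emb → ℕ) : Subgroup G where
  carrier := {σ | ∀ τ', n (σ • τ') = n τ'}
  one_mem' := fun τ' => by simp
  mul_mem' := by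
    intro a b ha hb τ'
    simp only [Set.mem_setOf_eq] at ha hb ⊢
    rw [mul_smul, ha, hb]
  inv_mem' := by
    intro a ha τ'
    simp only [Set.mem_setOf_eq] at ha ⊢
    have h := ha (a⁻¹ • τ')
    rw [smul_inv_smul] at h
    exact h.symm

variable {G}

/-- Membership in `sigStabilizer`. -/
theorem mem_sigStabilizer_iff {n : Emb → ℕ} {σ : G} :
    σ ∈ sigStabilizer G n ↔ ∀ τ', n (σ • τ') = n τ' :=
  Iff.rfl

/-- B2.4(a), (e): if the value `k` of the coefficient function is taken at `τ₁` and nowhere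
else, every `σ` stabilising the element fixes `τ₁`. -/
theorem sigStabilizer_le_stabilizer (n : Emb → ℕ) (τ₁ : Emb) (k : ℕ)
    (h : ∀ τ', n τ' = k ↔ τ' = τ₁) :
    sigStabilizer G n ≤ stabilizer G τ₁ := by
  intro σ hσ
  rw [mem_stabilizer_iff]
  have h1 : n (σ • τ₁) = k := by
    rw [(mem_sigStabilizer_iff).1 hσ τ₁]
    exact (h τ₁).2 rfl
  exact (h _).1 h1

/-- If `τ₁` has trivial stabiliser (a free action, e.g. the regular action of a Galois group on
the embeddings of a Galois field), the stabiliser of the element is trivial. -/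
theorem sigStabilizer_eq_bot (n : Emb → ℕ) (τ₁ : Emb) (k : ℕ)
    (h : ∀ τ', n τ' = k ↔ τ' = τ₁) (hfree : stabilizer G τ₁ = ⊥) :
    sigStabilizer G n = ⊥ :=
  le_bot_iff.1 (hfree ▸ sigStabilizer_le_stabilizer n τ₁ k h)

/-- A point with `σ • τ₁ = τ₁ → σ = 1` has trivial stabiliser. -/
theorem stabilizer_eq_bot_of_forall (τ₁ : Emb) (hfree : ∀ σ : G, σ • τ₁ = τ₁ → σ = 1) :
    stabilizer G τ₁ = ⊥ :=
  (Subgroup.eq_bot_iff_forall _).2 fun σ hσ => hfree σ ((mem_stabilizer_iff).1 hσ)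

end Stabilizer

section Signatures

variable (G : Type*) [Group G] {Emb : Type*} [MulAction G Emb] [DecidableEq Emb]

/-- The reduced signature element `sig'_{V,Φ} = Σ_τ q_τ τ⁻` of Liu (C.1) for the τ₁-nearby data:
`q = 1` at the one indefinite place, whose element of `Φ` is `τ₁`, and `q = 0` elsewhere — the
element `1·τ₁ ∈ ℕ[Emb]`. -/
def reducedSig (τ₁ : Emb) : Emb → ℕ := fun τ' => if τ' = τ₁ then 1 else 0

/-- `reducedSig τ₁` takes the value `1` exactly at `τ₁`. -/
theorem reducedSig_eq_one_iff (τ₁ τ' : Emb) : reducedSig τ₁ τ' = 1 ↔ τ' = τ₁ := by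
  by_cases h : τ' = τ₁ <;> simp [reducedSig, h]

/-- B2.4(a): the stabiliser of `sig' = 1·τ₁` is the stabiliser of the embedding `τ₁`. -/
theorem sigStabilizer_reducedSig (τ₁ : Emb) :
    sigStabilizer G (reducedSig τ₁) = stabilizer G τ₁ := by
  refine le_antisymm (sigStabilizer_le_stabilizer _ τ₁ 1 (reducedSig_eq_one_iff τ₁)) ?_
  intro σ hσ
  rw [mem_stabilizer_iff] at hσ
  intro τ'
  have key : σ • τ' = τ₁ ↔ τ' = τ₁ := by
    constructor
    · intro h
      rw [← hσ] at h
      exact smul_left_cancel σ h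
    · rintro rfl
      exact hσ
  by_cases hc : τ' = τ₁
  · subst hc
    simp [reducedSig, hσ]
  · have hc' : σ • τ' ≠ τ₁ := fun h => hc (key.1 h)
    simp [reducedSig, hc, hc']

/-- The non-reduced signature element `sig_{V,Φ} = Σ_τ (p_τ τ⁺ + q_τ τ⁻)` of Liu (C.1) for the
τ₁-nearby data of rank `n`, as a coefficient function on `Emb`: `q = 1` at `τ₁ ∈ Φ`, `q = 0` at the
other elements of `Φ`, `p = n − 1` at the conjugate `τ̄₁ ∈ Φ^c` of `τ₁`, `p = n` at the other
elements of `Φ^c`. (`Φ` is given as a predicate; `τ̄₁` as a point of the complement.) -/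
def nearbyFullSig (Φ : Set Emb) [DecidablePred (· ∈ Φ)] (τ₁ τ₁bar : Emb) (n : ℕ) : Emb → ℕ :=
  fun τ' => if τ' ∈ Φ then (if τ' = τ₁ then 1 else 0) else (if τ' = τ₁bar then n - 1 else n)

/-- B2.4(e): for `n ≠ 1, 2` the coefficient `1` of `sig_{V,Φ}` occurs at `τ₁` only, so that
`sigStabilizer (nearbyFullSig …) ≤ stabilizer τ₁` by `sigStabilizer_le_stabilizer`. -/
theorem nearbyFullSig_eq_one_iff (Φ : Set Emb) [DecidablePred (· ∈ Φ)] (τ₁ τ₁bar : Emb) (n : ℕ)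
    (hτ₁ : τ₁ ∈ Φ) (hn1 : n ≠ 1) (hn2 : n ≠ 2) (τ' : Emb) :
    nearbyFullSig Φ τ₁ τ₁bar n τ' = 1 ↔ τ' = τ₁ := by
  unfold nearbyFullSig
  by_cases hΦ : τ' ∈ Φ
  · by_cases h : τ' = τ₁
    · subst h
      simp [hτ₁]
    · simp [hΦ, h]
  · have hne : τ' ≠ τ₁ := fun h => hΦ (h ▸ hτ₁)
    by_cases hb : τ' = τ₁bar
    · rw [if_neg hΦ, if_pos hb]
      constructor
      · intro h
        exfalso
        omega
      · intro h
        exact absurd h hne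
    · rw [if_neg hΦ, if_neg hb]
      constructor
      · intro h
        exact absurd h hn1
      · intro h
        exact absurd h hne

/-- B2.4(e), group side: the non-reduced stabiliser of the nearby data (rank `n ≠ 1, 2`) is
contained in the stabiliser of `τ₁`, hence equals the reduced one when the latter is all of
`stabilizer τ₁`. -/
theorem sigStabilizer_nearbyFullSig_le (Φ : Set Emb) [DecidablePred (· ∈ Φ)] (τ₁ τ₁bar : Emb)
    (n : ℕ) (hτ₁ : τ₁ ∈ Φ) (hn1 : n ≠ 1) (hn2 : n ≠ 2) :
    sigStabilizer G (nearbyFullSig Φ τ₁ τ₁bar n) ≤ stabilizer G τ₁ :=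
  sigStabilizer_le_stabilizer _ τ₁ 1 (nearbyFullSig_eq_one_iff Φ τ₁ τ₁bar n hτ₁ hn1 hn2)

end Signatures

section Galois

/-- Liu Def. C.1 in the finite Galois model: the reflex field attached to the element with
coefficient function `n`, as the fixed field in `L` of its stabiliser in `Gal(L/K)`. -/
def reflexFieldOfSig (K L : Type*) [Field K] [Field L] [Algebra K L] {Emb : Type*}
    [MulAction (L ≃ₐ[K] L) Emb] (n : Emb → ℕ) : IntermediateField K L :=
  IntermediateField.fixedField (sigStabilizer (L ≃ₐ[K] L) n)

variable {K L : Type*} [Field K] [Field L] [Algebra K L]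

/-- B2.4(c), (e): if a coefficient of `n` is taken only at a point `τ₁` with trivial stabiliser,
the reflex field is the whole field `L`. -/
theorem reflexFieldOfSig_eq_top {Emb : Type*} [MulAction (L ≃ₐ[K] L) Emb] (n : Emb → ℕ) (τ₁ : Emb)
    (k : ℕ) (h : ∀ τ', n τ' = k ↔ τ' = τ₁) (hfree : stabilizer (L ≃ₐ[K] L) τ₁ = ⊥) :
    reflexFieldOfSig K L n = ⊤ := by
  unfold reflexFieldOfSig
  rw [sigStabilizer_eq_bot n τ₁ k h hfree]
  exact IntermediateField.fixedField_bot

variable (F : Type*) [Field F] [Algebra K F]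

/-- The action of `Gal(L/K)` on the set of `K`-embeddings `F →ₐ[K] L` by post-composition
(Liu p. 107 l. 16: «The Galois group Gal(C/Q) acts on Φ_E»). -/
scoped instance galEmbAction : MulAction (L ≃ₐ[K] L) (F →ₐ[K] L) where
  smul σ τ := σ.toAlgHom.comp τ
  one_smul τ := by
    ext x
    rfl
  mul_smul σ₁ σ₂ τ := by
    ext x
    rfl

/-- Unfolding lemma for the action. -/
theorem smul_emb_apply (σ : L ≃ₐ[K] L) (τ : F →ₐ[K] L) (x : F) : (σ • τ) x = σ (τ x) :=
  rfl

variable {F}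

/-- A surjective embedding `τ₁ : F → L` (i.e. `τ₁(F) = L`, the Galois case) has trivial
stabiliser: `σ ∘ τ₁ = τ₁` forces `σ = 1`. -/
theorem stabilizer_eq_bot_of_surjective (τ₁ : F →ₐ[K] L) (hτ : Function.Surjective τ₁) :
    stabilizer (L ≃ₐ[K] L) τ₁ = ⊥ := by
  refine stabilizer_eq_bot_of_forall τ₁ fun σ hσ => ?_
  ext x
  obtain ⟨y, rfl⟩ := hτ x
  have := AlgHom.congr_fun hσ y
  simpa [smul_emb_apply] using this

/-- B2.4(c), (e) — Liu Rem. C.2 «the reflex field of `h_{V,τ'}` is `τ'(E)`» in the Galois case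
`τ₁(F) = L`: for every signature element with a coefficient taken only at `τ₁` (the reduced
`sig' = 1·τ₁`, and the non-reduced `sig` of `nearbyFullSig_eq_one_iff` for `n ≠ 1, 2`), the
reflex field is `⊤ = L = τ₁(F)`. -/
theorem reflexFieldOfSig_eq_top_of_surjective (n : (F →ₐ[K] L) → ℕ) (τ₁ : F →ₐ[K] L)
    (hτ : Function.Surjective τ₁) (k : ℕ) (h : ∀ τ', n τ' = k ↔ τ' = τ₁) :
    reflexFieldOfSig K L n = ⊤ :=
  reflexFieldOfSig_eq_top n τ₁ k h (stabilizer_eq_bot_of_surjective τ₁ hτ)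

/-- The reduced reflex field `E'_{V(τ),Φ}` of the τ₁-nearby datum, in the Galois case. -/
theorem reflexFieldOfSig_reducedSig_eq_top [DecidableEq (F →ₐ[K] L)] (τ₁ : F →ₐ[K] L)
    (hτ : Function.Surjective τ₁) :
    reflexFieldOfSig K L (reducedSig τ₁) = ⊤ :=
  reflexFieldOfSig_eq_top_of_surjective _ τ₁ hτ 1 (reducedSig_eq_one_iff τ₁)

/-- The non-reduced reflex field `E_{V(τ),Φ}` of the τ₁-nearby datum of rank `n ≠ 1, 2`, in the
Galois case: also `⊤ = L = τ₁(F)` (B2.4(e)). -/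
theorem reflexFieldOfSig_nearbyFullSig_eq_top [DecidableEq (F →ₐ[K] L)]
    (Φ : Set (F →ₐ[K] L)) [DecidablePred (· ∈ Φ)] (τ₁ τ₁bar : F →ₐ[K] L) (n : ℕ)
    (hτ : Function.Surjective τ₁) (hτ₁ : τ₁ ∈ Φ) (hn1 : n ≠ 1) (hn2 : n ≠ 2) :
    reflexFieldOfSig K L (nearbyFullSig Φ τ₁ τ₁bar n) = ⊤ :=
  reflexFieldOfSig_eq_top_of_surjective _ τ₁ hτ 1
    (nearbyFullSig_eq_one_iff Φ τ₁ τ₁bar n hτ₁ hn1 hn2)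

/-- A `K`-embedding of `F` into `L` is surjective as soon as the `K`-dimensions agree
(`[F : K] = [L : K] < ∞`) — the Galois case `L = τ₁(F)`. -/
theorem surjective_of_finrank_eq [FiniteDimensional K L] (τ₁ : F →ₐ[K] L)
    (hdim : Module.finrank K F = Module.finrank K L) : Function.Surjective τ₁ := by
  have hinj : Function.Injective τ₁ := τ₁.toRingHom.injective
  have hF : FiniteDimensional K F := by
    have : Module.finrank K F ≠ 0 := by
      rw [hdim]
      exact Module.finrank_pos.ne'
    exact Module.finite_of_finrank_pos (Nat.pos_of_ne_zero this)
  exact (LinearMap.injective_iff_surjective_of_finrank_eq_finrank (f := τ₁.toLinearMap) hdim).1 hinj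

end Galois

end Summit.Ventures.HodgeRepro2.ReflexSignature
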